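import Literature.NumberTheory.PAdicHodge.CMFibreCellsGoodOrdinaryData
import Literature.NumberTheory.PAdicHodge.AinfWeierstrassRamifiedCellsOrdinary
import Literature.NumberTheory.EllipticCurves.HasseInvariantJZeroJ1728
import HarnessLib

/-!
# The CM fibres `E₀ ∈ {y² = x³ + a x, y² = x³ + b}` of the cell models: good ORDINARY data at EVERY prime `p ≥ 5`
# under Deuring's congruence (`p ≡ 1 (mod 4)` resp. `p ≡ 1 (mod 3)`)

Topic `Literature/NumberTheory/PAdicHodge`; namespace `Literature.NumberTheory.PAdicHodge`. THEOREMS ONLY (no definition, no named fact, no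
instance, no `sorry`). The `p ∈ {5, 7}` files `CMFibreCellsGoodOrdinaryData` / `AinfWeierstrassRamifiedCellsOrdinary` key the good ordinary
model data of the cell model `W_D = ⟨0, 0, 0, a ϱ^{r₄}, b ϱ^{r₆}⟩` over `𝒪_D = ℤ_p[ϱ]` (`ϱ^e = p`) to the PRIME: at `5` the fibre is `y² = x³ + a x`
(`A_5 = 32 ā`), at `7` it is `y² = x³ + b` (`A_7 = 192 b̄`). The only prime-specific input is the Hasse coefficient of the two CM fibres, which
`EllipticCurves/HasseInvariantJZeroJ1728` (Deuring, explicit form) now supplies at EVERY odd prime. This file re-keys the data to the PATTERN of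
the numerology and Deuring's congruence, for any prime `p ≥ 5`:

* pattern `J1728` — `r₄ = 0`, `t₄ = 0 < t₆` (hence `r₆ > 0`), fibre `y² = x³ + a x`, ORDINARY iff `p ≡ 1 (mod 4)`;
* pattern `J0` — `r₆ = 0`, `t₆ = 0 < t₄` (hence `r₄ > 0`), fibre `y² = x³ + b`, ORDINARY iff `p ≡ 1 (mod 3)`.

§1 (`ℤ`-side, `E₀ = ⟨0, 0, 0, [r₄ = 0] a, [r₆ = 0] b⟩`): `not_dvd_of_isUnit_ord` (`p ∤ a` resp. `p ∤ b` from the unit `64a³p^{t₄} + 432b²p^{t₆} ∈ ℤ_pˣ`),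
`not_dvd_Δ_cmFibre_ord_anyPrime`, ★ `hasseCoeff_cmFibre_ne_zero_anyPrime` (Deuring), `not_dvd_tr_cmFibre_anyPrime` (`A_p ≡ a_p`),
`norm_intCast_tr_cmFibre_eq_one_anyPrime`, `tr_cmFibre_sq_lt_four_mul_anyPrime` (Hasse–Manin);
§2 (`𝒪_F`-side): `hasseCoeff_map_model_ne_zero_j1728` / `…_j0` (the model's reduction along any `γ : 𝒪_D → k`, `char k = p`),
`isUnit_of_isUnit_ord` (`a ∈ ℤ_pˣ` resp. `b ∈ ℤ_pˣ`), ★ `AinfTop.hasseCoeff_red_map_model_ne_zero_anyPrime` and `…_of_isUnit_anyPrime`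
(`A_p(W_D ⊗_β 𝒪_F mod 𝔪_F) ≠ 0`).

Purpose: the good-ordinary model data `exists_goodModelData_of_ordinary_numerology` of the K★ line (route `EdixhovenFibreFiveSeven`) at every
(G)-ORDINARY potentially good additive prime `p ≥ 5` — crux TDS11 `stmt-BirchSwinnertonDyer-22228` and the `p > 7` Manin lever of
`TeichmullerTwistDescent` ((G)-ordinarity forces `e ∣ p − 1`, tree `TeichmullerTwistDescentTameExponent.semistabilityIndex_dvd_sub_one`, i.e. exactly
the congruences above for `e = 4` resp. `e ∈ {3, 6}`). Infrastructure only; BSD is not proved by any of this.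

## References
* [SilvermanAEC2009] J. H. Silverman, *AEC* (2009), III.1, V.1.1 (Hasse), V.4.1 (Deuring), Ex. V.4.4–4.5, VII.5.5.
* [Serre1972] J.-P. Serre, Invent. Math. 15 (1972), §1.11.
-/

noncomputable section

open scoped Classical
open Field ValuativeRel Polynomial

namespace Literature.NumberTheory.PAdicHodge

open Literature.NumberTheory.GaloisRepresentations
open Literature.NumberTheory.GaloisRepresentations.IsNonarchimedeanLocalField
open Literature.NumberTheory.GaloisRepresentations.LubinTate
open Literature.NumberTheory.EllipticCurves

/-! ## §1 The `ℤ`-curve `E₀` -/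

section CMFibre

variable {p : ℕ} [hp : Fact p.Prime] (a b : ℤ) (r₄ r₆ : ℕ)

/-- `p ∤ 64` and `p ∤ 432` for a prime `p ≥ 5`. [folklore] -/
private theorem not_dvd_64_432 (hp5 : 5 ≤ p) : ¬ (p : ℤ) ∣ 64 ∧ ¬ (p : ℤ) ∣ 432 := by
  have hpr : p.Prime := hp.out
  have hP : Prime (p : ℤ) := Nat.prime_iff_prime_int.mp hpr
  have h2 : ¬ (p : ℤ) ∣ 2 := fun h => by
    have := Int.le_of_dvd two_pos h; omega
  have h3 : ¬ (p : ℤ) ∣ 3 := fun h => by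
    have := Int.le_of_dvd three_pos h; omega
  refine ⟨fun h => h2 (hP.dvd_of_dvd_pow (show (p : ℤ) ∣ 2 ^ 6 by simpa using h)), fun h => ?_⟩
  rcases hP.dvd_or_dvd (show (p : ℤ) ∣ 2 ^ 4 * 3 ^ 3 by simpa using h) with h' | h'
  · exact h2 (hP.dvd_of_dvd_pow h')
  · exact h3 (hP.dvd_of_dvd_pow h')

/-- **`p ∤ a` (pattern `t₄ = 0 < t₆`) resp. `p ∤ b` (pattern `t₄ > 0 = t₆`) from the unit `64a³p^{t₄} + 432b²p^{t₆} ∈ ℤ_pˣ`**, any prime `p ≥ 5`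
(the unit is `≡ 64a³` resp. `≡ 432b²` modulo `p`, and `p ∤ 64·432`). [cite: SilvermanAEC2009, VII.5.5] -/
theorem not_dvd_of_isUnit_ord (hp5 : 5 ≤ p) {t₄ t₆ : ℕ} (ht : t₄ = 0 ∧ 0 < t₆ ∨ 0 < t₄ ∧ t₆ = 0)
    (hu : IsUnit (64 * (a : ℤ_[p]) ^ 3 * (p : ℤ_[p]) ^ t₄ + 432 * (b : ℤ_[p]) ^ 2 * (p : ℤ_[p]) ^ t₆)) :
    (t₄ = 0 → ¬ (p : ℤ) ∣ a) ∧ (t₆ = 0 → ¬ (p : ℤ) ∣ b) := by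
  have key : ∀ (x y : ℤ_[p]), IsUnit (x + (p : ℤ_[p]) * y) → IsUnit x := fun x y h => by
    by_contra hx
    have hxm : x ∈ IsLocalRing.maximalIdeal ℤ_[p] := (IsLocalRing.mem_maximalIdeal _).2 hx
    have hym : (p : ℤ_[p]) * y ∈ IsLocalRing.maximalIdeal ℤ_[p] := by
      rw [PadicInt.maximalIdeal_eq_span_p]; exact Ideal.mul_mem_right _ _ (Ideal.mem_span_singleton_self _)
    exact (IsLocalRing.mem_maximalIdeal _).1 (Ideal.add_mem _ hxm hym) h
  have hint : ∀ (n : ℤ) (k : ℕ) (c : ℤ_[p]), IsUnit ((c * (n : ℤ_[p]) ^ k)) → 0 < k → ¬ (p : ℤ) ∣ n := fun n k c h hk hdvd => by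
    have hn : ¬ IsUnit ((n : ℤ_[p])) := fun hu' => by
      have := PadicInt.isUnit_iff.1 hu'
      exact absurd this (ne_of_lt ((PadicInt.norm_int_lt_one_iff_dvd n).2 hdvd))
    exact hn (isUnit_of_dvd_unit (dvd_mul_of_dvd_right (dvd_pow_self _ hk.ne') _) h)
  rcases ht with ⟨h₄, h₆⟩ | ⟨h₄, h₆⟩
  · refine ⟨fun _ => ?_, fun h => by omega⟩
    rw [h₄, pow_zero, mul_one] at hu
    obtain ⟨t, rfl⟩ : ∃ t, t₆ = t + 1 := ⟨t₆ - 1, by omega⟩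
    have hu' : IsUnit (64 * (a : ℤ_[p]) ^ 3 + (p : ℤ_[p]) * (432 * (b : ℤ_[p]) ^ 2 * (p : ℤ_[p]) ^ t)) := by
      convert hu using 1; ring
    have h64 : IsUnit ((64 : ℤ) : ℤ_[p]) := by
      rw [PadicInt.isUnit_iff]
      exact le_antisymm (PadicInt.norm_le_one _)
        (not_lt.1 fun h => (not_dvd_64_432 hp5).1 ((PadicInt.norm_int_lt_one_iff_dvd _).1 h))
    have hu'' : IsUnit (((64 : ℤ) : ℤ_[p]) * (a : ℤ_[p]) ^ 3) := by push_cast; exact key _ _ hu'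
    exact hint a 3 _ hu'' three_pos
  · refine ⟨fun h => by omega, fun _ => ?_⟩
    rw [h₆, pow_zero, mul_one] at hu
    obtain ⟨t, rfl⟩ : ∃ t, t₄ = t + 1 := ⟨t₄ - 1, by omega⟩
    have hu' : IsUnit (432 * (b : ℤ_[p]) ^ 2 + (p : ℤ_[p]) * (64 * (a : ℤ_[p]) ^ 3 * (p : ℤ_[p]) ^ t)) := by
      convert hu using 1; ring
    have hu'' : IsUnit (((432 : ℤ) : ℤ_[p]) * (b : ℤ_[p]) ^ 2) := by push_cast; exact key _ _ hu'
    exact hint b 2 _ hu'' two_pos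

/-- ★ **`p ∤ Δ(E₀)`** at any prime `p ≥ 5`: pattern `r₄ = 0 < r₆` from `p ∤ a` (`E₀ = y² = x³ + a x`, `Δ = −64a³`), pattern `r₄ > 0 = r₆` from
`p ∤ b` (`E₀ = y² = x³ + b`, `Δ = −432b²`). [cite: SilvermanAEC2009, III.1 and VII.5] -/
theorem not_dvd_Δ_cmFibre_ord_anyPrime (hp5 : 5 ≤ p) (hr : r₄ = 0 ∧ 0 < r₆ ∨ 0 < r₄ ∧ r₆ = 0)
    (ha : r₄ = 0 → ¬ (p : ℤ) ∣ a) (hb : r₆ = 0 → ¬ (p : ℤ) ∣ b) :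
    ¬ (p : ℤ) ∣ ((⟨0, 0, 0, if r₄ = 0 then a else 0, if r₆ = 0 then b else 0⟩ : WeierstrassCurve ℤ)).Δ := by
  have hP : Prime (p : ℤ) := Nat.prime_iff_prime_int.mp hp.out
  rcases hr with ⟨h₄, h₆⟩ | ⟨h₄, h₆⟩
  · rw [Δ_cmFibre_seven a b r₄ r₆ h₄ h₆, dvd_neg]
    intro h
    rcases hP.dvd_or_dvd h with h' | h'
    · exact (not_dvd_64_432 hp5).1 h'
    · exact ha h₄ (hP.dvd_of_dvd_pow h')
  · rw [Δ_cmFibre_five a b r₄ r₆ h₄ h₆, dvd_neg]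
    intro h
    rcases hP.dvd_or_dvd h with h' | h'
    · exact (not_dvd_64_432 hp5).2 h'
    · exact hb h₆ (hP.dvd_of_dvd_pow h')

/-- ★ **`A_p(E₀ mod p) ≠ 0` — Deuring, any prime `p ≥ 5`**: pattern `r₄ = 0 < r₆` with `p ≡ 1 (mod 4)` and `p ∤ a` (`y² = x³ + a x`, `j = 1728`,
`A_p = 4^m C(m, m/2) ā^{m/2}`), pattern `r₄ > 0 = r₆` with `p ≡ 1 (mod 3)` and `p ∤ b` (`y² = x³ + b`, `j = 0`, `A_p = 4^m C(m, 2m/3) b̄^{m/3}`).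
[cite: SilvermanAEC2009, V.4.1 and Ex. V.4.4–4.5] -/
theorem hasseCoeff_cmFibre_ne_zero_anyPrime (hr : r₄ = 0 ∧ 0 < r₆ ∧ p % 4 = 1 ∨ 0 < r₄ ∧ r₆ = 0 ∧ p % 3 = 1)
    (ha : r₄ = 0 → ¬ (p : ℤ) ∣ a) (hb : r₆ = 0 → ¬ (p : ℤ) ∣ b) :
    ((⟨0, 0, 0, if r₄ = 0 then a else 0, if r₆ = 0 then b else 0⟩ : WeierstrassCurve ℤ).map (Int.castRingHom (ZMod p))).hasseCoeff p ≠ 0 := by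
  rw [map_cmFibre]
  rcases hr with ⟨h₄, h₆, hp4⟩ | ⟨h₄, h₆, hp3⟩
  · rw [if_pos h₄, if_neg h₆.ne', eq_intCast, eq_intCast, Int.cast_zero]
    refine hasseCoeff_j1728_ne_zero hp4 ?_
    rw [Ne, ZMod.intCast_zmod_eq_zero_iff_dvd]; exact ha h₄
  · have hp2 : p ≠ 2 := by rintro rfl; norm_num at hp3
    rw [if_neg h₄.ne', if_pos h₆, eq_intCast, eq_intCast, Int.cast_zero]
    refine hasseCoeff_jZero_ne_zero hp2 hp3 ?_
    rw [Ne, ZMod.intCast_zmod_eq_zero_iff_dvd]; exact hb h₆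

/-- ★ **`p ∤ a_p(E₀)`** (`A_p ≡ a_p (mod p)`, `hasseCoeff_eq_zero_iff_dvd_tr`), any prime `p ≥ 5` under Deuring's congruence.
[cite: SilvermanAEC2009, Thm. V.4.1(a) and Ex. V.5.10] -/
theorem not_dvd_tr_cmFibre_anyPrime (hp5 : 5 ≤ p) (hr : r₄ = 0 ∧ 0 < r₆ ∧ p % 4 = 1 ∨ 0 < r₄ ∧ r₆ = 0 ∧ p % 3 = 1)
    (ha : r₄ = 0 → ¬ (p : ℤ) ∣ a) (hb : r₆ = 0 → ¬ (p : ℤ) ∣ b) :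
    ¬ (p : ℤ) ∣ HasseManin.tr
      ((⟨0, 0, 0, if r₄ = 0 then a else 0, if r₆ = 0 then b else 0⟩ : WeierstrassCurve ℤ).map (Int.castRingHom (ZMod p))) := by
  have hr' : r₄ = 0 ∧ 0 < r₆ ∨ 0 < r₄ ∧ r₆ = 0 := hr.imp (fun h => ⟨h.1, h.2.1⟩) (fun h => ⟨h.1, h.2.1⟩)
  haveI := isElliptic_cmFibre_map_zmod (p := p) _ (not_dvd_Δ_cmFibre_ord_anyPrime a b r₄ r₆ hp5 hr' ha hb)
  have hp2 : p ≠ 2 := by omega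
  rw [← WeierstrassCurve.hasseCoeff_eq_zero_iff_dvd_tr _ hp2]
  exact hasseCoeff_cmFibre_ne_zero_anyPrime a b r₄ r₆ hr ha hb

/-- **`‖a_p(E₀)‖_p = 1`**, any prime `p ≥ 5` under Deuring's congruence (the hypothesis of `FrobeniusUnitRoot.exists_unitRoot_frobeniusPoly`).
[cite: SilvermanAEC2009, Thm. V.4.1(a)] -/
theorem norm_intCast_tr_cmFibre_eq_one_anyPrime (hp5 : 5 ≤ p) (hr : r₄ = 0 ∧ 0 < r₆ ∧ p % 4 = 1 ∨ 0 < r₄ ∧ r₆ = 0 ∧ p % 3 = 1)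
    (ha : r₄ = 0 → ¬ (p : ℤ) ∣ a) (hb : r₆ = 0 → ¬ (p : ℤ) ∣ b) :
    ‖((HasseManin.tr ((⟨0, 0, 0, if r₄ = 0 then a else 0, if r₆ = 0 then b else 0⟩ : WeierstrassCurve ℤ).map
        (Int.castRingHom (ZMod p))) : ℤ) : ℤ_[p])‖ = 1 := by
  have h := not_dvd_tr_cmFibre_anyPrime a b r₄ r₆ hp5 hr ha hb
  refine le_antisymm (PadicInt.norm_le_one _) ?_
  by_contra hlt
  exact h ((PadicInt.norm_int_lt_one_iff_dvd _).1 (not_le.1 hlt))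

/-- ★ **`a_p(E₀)² < 4p`** (Hasse–Manin), any prime `p ≥ 5` (the hypothesis of `UnitRootPeriodWitt.unitRoot_pow_ne_one`).
[cite: SilvermanAEC2009, Thm. V.1.1] -/
theorem tr_cmFibre_sq_lt_four_mul_anyPrime (hp5 : 5 ≤ p) (hr : r₄ = 0 ∧ 0 < r₆ ∨ 0 < r₄ ∧ r₆ = 0)
    (ha : r₄ = 0 → ¬ (p : ℤ) ∣ a) (hb : r₆ = 0 → ¬ (p : ℤ) ∣ b) :
    HasseManin.tr ((⟨0, 0, 0, if r₄ = 0 then a else 0, if r₆ = 0 then b else 0⟩ : WeierstrassCurve ℤ).map (Int.castRingHom (ZMod p))) ^ 2 <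
      4 * p := by
  set E := ((⟨0, 0, 0, if r₄ = 0 then a else 0, if r₆ = 0 then b else 0⟩ : WeierstrassCurve ℤ).map (Int.castRingHom (ZMod p))) with hE
  haveI : E.IsElliptic := isElliptic_cmFibre_map_zmod (p := p) _ (not_dvd_Δ_cmFibre_ord_anyPrime a b r₄ r₆ hp5 hr ha hb)
  have hsq : HasseManin.tr E ^ 2 ≤ 4 * (Fintype.card (ZMod p) : ℤ) :=
    HasseManin.sq_le_four_mul (fun n => HasseManin.dg_nonneg E n) (fun n hn => HasseManin.dg_succ_eq_one_of_dg_eq_zero E hn)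
  rw [ZMod.card] at hsq
  exact sq_lt_four_mul_of_sq_le hp.out hsq

end CMFibre

/-! ## §2 The model over `𝒪_D` and its `𝒪_F`-reduction -/

section Model

variable {p : ℕ} [Fact p.Prime] {e : ℕ}

/-- **`A_p ≠ 0` for the model when `r₄ = 0 < r₆`, `a ∈ ℤ_pˣ`, `p ≡ 1 (mod 4)`** (reduction `y² = x³ + ā x`, `j̃ = 1728`, ORDINARY by Deuring), read along
any `γ : 𝒪_D → k` into a field of characteristic `p`. [cite: SilvermanAEC2009, V.4.1 and Ex. V.4.5] -/
theorem hasseCoeff_map_model_ne_zero_j1728 (hp4 : p % 4 = 1) {f : ℤ_[p][X]}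
    (hroot : AdjoinRoot.root f ^ e = AdjoinRoot.of f (p : ℕ)) (a b : ℤ_[p]) {r₄ r₆ : ℕ} (hr₄ : r₄ = 0) (hr₆ : 0 < r₆) (ha : IsUnit a)
    {k : Type*} [Field k] [CharP k p] (γ : AdjoinRoot f →+* k) :
    ((⟨0, 0, 0, AdjoinRoot.of f a * AdjoinRoot.root f ^ r₄, AdjoinRoot.of f b * AdjoinRoot.root f ^ r₆⟩ :
        WeierstrassCurve (AdjoinRoot f)).map γ).hasseCoeff p ≠ 0 := by
  rw [map_model_eq_map_castHom hroot a b r₄ r₆ γ, if_pos hr₄, if_neg hr₆.ne', WeierstrassCurve.map_hasseCoeff,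
    map_ne_zero_iff _ (RingHom.injective _)]
  exact hasseCoeff_j1728_ne_zero hp4 ((ha.map PadicInt.toZMod).ne_zero)

/-- **`A_p ≠ 0` for the model when `r₄ > 0 = r₆`, `b ∈ ℤ_pˣ`, `p ≡ 1 (mod 3)`** (reduction `y² = x³ + b̄`, `j̃ = 0`, ORDINARY by Deuring), read along any
`γ : 𝒪_D → k` into a field of characteristic `p`. [cite: SilvermanAEC2009, V.4.1 and Ex. V.4.4] -/
theorem hasseCoeff_map_model_ne_zero_j0 (hp2 : p ≠ 2) (hp3 : p % 3 = 1) {f : ℤ_[p][X]}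
    (hroot : AdjoinRoot.root f ^ e = AdjoinRoot.of f (p : ℕ)) (a b : ℤ_[p]) {r₄ r₆ : ℕ} (hr₄ : 0 < r₄) (hr₆ : r₆ = 0) (hb : IsUnit b)
    {k : Type*} [Field k] [CharP k p] (γ : AdjoinRoot f →+* k) :
    ((⟨0, 0, 0, AdjoinRoot.of f a * AdjoinRoot.root f ^ r₄, AdjoinRoot.of f b * AdjoinRoot.root f ^ r₆⟩ :
        WeierstrassCurve (AdjoinRoot f)).map γ).hasseCoeff p ≠ 0 := by
  rw [map_model_eq_map_castHom hroot a b r₄ r₆ γ, if_neg hr₄.ne', if_pos hr₆, WeierstrassCurve.map_hasseCoeff,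
    map_ne_zero_iff _ (RingHom.injective _)]
  exact hasseCoeff_jZero_ne_zero hp2 hp3 ((hb.map PadicInt.toZMod).ne_zero)

/-- **`a ∈ ℤ_pˣ` (pattern `t₄ = 0 < t₆`) resp. `b ∈ ℤ_pˣ` (pattern `t₄ > 0 = t₆`) from the unit `64a³p^{t₄} + 432b²p^{t₆} ∈ ℤ_pˣ`**, any prime `p ≥ 5`.
[cite: SilvermanAEC2009, VII.5.5] -/
theorem isUnit_of_isUnit_ord (a b : ℤ_[p]) {t₄ t₆ : ℕ} (ht : t₄ = 0 ∧ 0 < t₆ ∨ 0 < t₄ ∧ t₆ = 0)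
    (hu : IsUnit (64 * a ^ 3 * (p : ℤ_[p]) ^ t₄ + 432 * b ^ 2 * (p : ℤ_[p]) ^ t₆)) :
    (t₄ = 0 → IsUnit a) ∧ (t₆ = 0 → IsUnit b) := by
  have key : ∀ (x y : ℤ_[p]), IsUnit (x + (p : ℤ_[p]) * y) → IsUnit x := fun x y h => by
    by_contra hx
    have hxm : x ∈ IsLocalRing.maximalIdeal ℤ_[p] := (IsLocalRing.mem_maximalIdeal _).2 hx
    have hym : (p : ℤ_[p]) * y ∈ IsLocalRing.maximalIdeal ℤ_[p] := by
      rw [PadicInt.maximalIdeal_eq_span_p]; exact Ideal.mul_mem_right _ _ (Ideal.mem_span_singleton_self _)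
    exact (IsLocalRing.mem_maximalIdeal _).1 (Ideal.add_mem _ hxm hym) h
  have hfac : ∀ (n c : ℤ_[p]) (k : ℕ), IsUnit (c * n ^ k) → 0 < k → IsUnit n := fun n c k h hk =>
    isUnit_of_dvd_unit (dvd_mul_of_dvd_right (dvd_pow_self _ hk.ne') _) h
  rcases ht with ⟨h₄, h₆⟩ | ⟨h₄, h₆⟩
  · refine ⟨fun _ => ?_, fun h => by omega⟩
    rw [h₄, pow_zero, mul_one] at hu
    obtain ⟨t, rfl⟩ : ∃ t, t₆ = t + 1 := ⟨t₆ - 1, by omega⟩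
    have hu' : IsUnit (64 * a ^ 3 + (p : ℤ_[p]) * (432 * b ^ 2 * (p : ℤ_[p]) ^ t)) := by
      convert hu using 1; ring
    exact hfac a 64 3 (key _ _ hu') three_pos
  · refine ⟨fun h => by omega, fun _ => ?_⟩
    rw [h₆, pow_zero, mul_one] at hu
    obtain ⟨t, rfl⟩ : ∃ t, t₄ = t + 1 := ⟨t₄ - 1, by omega⟩
    have hu' : IsUnit (432 * b ^ 2 + (p : ℤ_[p]) * (64 * a ^ 3 * (p : ℤ_[p]) ^ t)) := by
      convert hu using 1; ring
    exact hfac b 432 2 (key _ _ hu') two_pos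

end Model

namespace AinfTop

variable {F : Type} [Field F] [ValuativeRel F] [TopologicalSpace F] [IsNonarchimedeanLocalField F] [CharZero F]
  {p : ℕ} [Fact p.Prime] {hp : valuation F p < 1} {D : EisensteinRoot F p hp} [CharP 𝓀[F] p] {e : ℕ}
  (hD : D.poly = X ^ e - C (p : ℤ_[p])) (β : D.Coeff →+* LTCoeff F) (a b : ℤ_[p]) {r₄ r₆ t₄ t₆ : ℕ}

include hD

/-- ★ **ORDINARY reduction of `W_D ⊗_β 𝒪_F` at any prime `p ≥ 5`** for the model on the pattern `r₄ = 0 < r₆`, `p ≡ 1 (mod 4)`, `a ∈ ℤ_pˣ`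
(`j̃ = 1728`) resp. `r₄ > 0 = r₆`, `p ≡ 1 (mod 3)`, `b ∈ ℤ_pˣ` (`j̃ = 0`), read along `redCoeff F ∘ β : 𝒪_D → 𝓀_F`: `A_p(W mod 𝔪_F) ≠ 0`.
[cite: SilvermanAEC2009, V.4.1 and Ex. V.4.4–4.5] -/
theorem hasseCoeff_red_map_model_ne_zero_anyPrime (hp5 : 5 ≤ p)
    (hr : r₄ = 0 ∧ 0 < r₆ ∧ p % 4 = 1 ∨ 0 < r₄ ∧ r₆ = 0 ∧ p % 3 = 1)
    (ha : r₄ = 0 → IsUnit a) (hb : r₆ = 0 → IsUnit b) :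
    (((⟨0, 0, 0, AdjoinRoot.of D.poly a * AdjoinRoot.root D.poly ^ r₄, AdjoinRoot.of D.poly b * AdjoinRoot.root D.poly ^ r₆⟩ :
      WeierstrassCurve D.Coeff).map β).map (redCoeff F)).hasseCoeff p ≠ 0 := by
  rw [WeierstrassCurve.map_map]
  have hroot := D.root_pow_eq_of_poly_eq hD
  rcases hr with ⟨h₄, h₆, hp4⟩ | ⟨h₄, h₆, hp3⟩
  · exact hasseCoeff_map_model_ne_zero_j1728 hp4 hroot a b h₄ h₆ (ha h₄) _
  · exact hasseCoeff_map_model_ne_zero_j0 (by omega) hp3 hroot a b h₄ h₆ (hb h₆) _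

/-- ★ **ORDINARY reduction of `W_D ⊗_β 𝒪_F` from the unit, any prime `p ≥ 5`**: on the pattern `r₄ = 0`, `t₄ = 0 < t₆`, `p ≡ 1 (mod 4)` resp.
`r₆ = 0`, `t₆ = 0 < t₄`, `p ≡ 1 (mod 3)`, with `2r₆ = e t₆` / `3r₄ = e t₄` (so the other exponent is positive) and `64a³p^{t₄} + 432b²p^{t₆} ∈ ℤ_pˣ`:
`A_p(W mod 𝔪_F) ≠ 0`. [cite: SilvermanAEC2009, V.4.1 and VII.5.5] [cite: Serre1972, §1.11] -/
theorem hasseCoeff_red_map_model_ne_zero_of_isUnit_anyPrime (hp5 : 5 ≤ p) (he : 0 < e) (h₄ : 3 * r₄ = e * t₄) (h₆ : 2 * r₆ = e * t₆)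
    (hpat : r₄ = 0 ∧ t₄ = 0 ∧ 0 < t₆ ∧ p % 4 = 1 ∨ r₆ = 0 ∧ t₆ = 0 ∧ 0 < t₄ ∧ p % 3 = 1)
    (hu : IsUnit (64 * a ^ 3 * (p : ℤ_[p]) ^ t₄ + 432 * b ^ 2 * (p : ℤ_[p]) ^ t₆)) :
    (((⟨0, 0, 0, AdjoinRoot.of D.poly a * AdjoinRoot.root D.poly ^ r₄, AdjoinRoot.of D.poly b * AdjoinRoot.root D.poly ^ r₆⟩ :
      WeierstrassCurve D.Coeff).map β).map (redCoeff F)).hasseCoeff p ≠ 0 := by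
  rcases hpat with ⟨hr₄, ht₄, ht₆, hp4⟩ | ⟨hr₆, ht₆, ht₄, hp3⟩
  · have hr₆ : 0 < r₆ := by
      rcases Nat.eq_zero_or_pos r₆ with h0 | h0
      · exfalso; rw [h0, mul_zero] at h₆; have := Nat.mul_pos he ht₆; omega
      · exact h0
    have hab := isUnit_of_isUnit_ord a b (Or.inl ⟨ht₄, ht₆⟩) hu
    exact hasseCoeff_red_map_model_ne_zero_anyPrime hD β a b hp5 (Or.inl ⟨hr₄, hr₆, hp4⟩) (fun _ => hab.1 ht₄) (fun h => by omega)
  · have hr₄ : 0 < r₄ := by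
      rcases Nat.eq_zero_or_pos r₄ with h0 | h0
      · exfalso; rw [h0, mul_zero] at h₄; have := Nat.mul_pos he ht₄; omega
      · exact h0
    have hab := isUnit_of_isUnit_ord a b (Or.inr ⟨ht₄, ht₆⟩) hu
    exact hasseCoeff_red_map_model_ne_zero_anyPrime hD β a b hp5 (Or.inr ⟨hr₄, hr₆, hp3⟩) (fun h => by omega) (fun _ => hab.2 ht₆)

end AinfTop

end Literature.NumberTheory.PAdicHodge

end
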